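import Summits.QuantumAdvantage.QuantumAdvantage.Statement
import Summits.QuantumAdvantage.QuantumAdvantage.Theorems.SoloBlindCeiling
import Summits.QuantumAdvantage.QuantumAdvantage.Theorems.SoloBlindRung
import Literature.Computability.QuantumComplexity.BQTime
import Literature.Computability.Complexity.RelativizedTime
import Literature.Computability.Complexity.ProbabilisticClassesProofs
import HarnessLib

/-!
# The rung lattice of `QuantumAdvantage`: padding-free splittings of the sandwich
# `C ⊆ BPP ⊆ BQP ⊆ D`

`QuantumAdvantage` is `¬ (BQP ⊆ BPP)` (`soloBlind_quantumAdvantage_iff_not_subset`). For every class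
`C ⊆ BPP` and every class `D ⊇ BQP` the two elementary sandwich identities

* `¬ (BQP ⊆ C) ↔ QuantumAdvantage ∨ ¬ (BPP ⊆ C)`   (`soloBlind_below_iff`),
* `¬ (D ⊆ BPP) ↔ QuantumAdvantage ∨ ¬ (D ⊆ BQP)`   (`soloBlind_above_iff`)

organise the consequences of the summit into a lattice of RUNGS, each of the form
"summit ∨ (a purely classical, resp. purely quantum, hierarchy statement)". This file records the
lattice with the tree's own classes, sorry-free and WITHOUT the padding hypotheses that
`SoloBlindRung.lean` needed:

* below `BPP`: `C = P` ("`BQP ≠ P`" is `Summit ∨ P ≠ BPP`, and already forces `P ≠ PSPACE`),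
  `C = ZPP`, `C = RP`, and the fixed-polynomial rungs `C = BPTIME(n^k)`
  (`soloBlind_fixedPoly_rung_iff`; `k = 1`: "polynomial-time quantum computation is not inside
  probabilistic LINEAR time" is `Summit ∨ BPTIME(n) ≠ BPP`, the Fortnow–Sipser / Rettinger–Verbeek
  hierarchy question), with the family form `(∀ k, BQP ⊄ BPTIME(n^k)) ↔ Summit ∨ ∀ k, BPP ⊄ BPTIME(n^k)`;
  unlike "`BQP ≠ P`", the fixed-polynomial rungs hold in the world `P = PSPACE`
  (`soloBlind_fixedPoly_rung_of_P_eq_PSPACE`, given the standard `PSPACE ⊄ BPTIME(n^k)`);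
* above `BQP`: `D = BQTIME(quasipoly)` gives the padding-free form of the v3 rung dichotomy,
  `¬ (BQQP ⊆ BPP) ↔ Summit ∨ ¬ (BQQP ⊆ BQP)` — the rung is exactly "summit, or the QUANTUM
  quasi-polynomial time hierarchy" (`soloBlind_rung_iff_quantumHierarchy`; compare
  `soloBlind_rung_iff`, which reads the second disjunct classically modulo three padding facts);
  `D = PP`, `D = PSPACE` split the ceiling separations of `SoloBlindCeiling.lean` the same way.

Every right-hand disjunct is an open hierarchy/separation question for a semantic class
(BPTIME hierarchies: open even at one level, known only with one bit of advice or at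
Karpinski–Verbeek gaps — Cai–Nerurkar–Sivakumar 1999 §1; Lu–Oliveira–Santhanam 2021 §1;
Fortnow–Santhanam–Trevisan 2004, Thms. 1–2 for `BQTIME` with advice). Nothing here is progress
towards the summit; it is the kernel-checked index of its weakest open consequences.

References: J.-Y. Cai, A. Nerurkar, D. Sivakumar, *Hardness and hierarchy theorems for
probabilistic quasi-polynomial time*, STOC 1999, §1 and Thms. 2, 4; Z. Lu, I. C. Oliveira,
R. Santhanam, *Pseudodeterministic algorithms and the structure of probabilistic time*, STOC 2021,
§1; L. Fortnow, R. Santhanam, L. Trevisan, *Promise hierarchies*, ECCC TR04-098 (2004), Thms. 1–2;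
R. Rettinger, R. Verbeek, *Monte-Carlo polynomial versus linear time — the truth-table case*,
FCT 2001, LNCS 2138; S. Arora, B. Barak, *Computational Complexity* (2009), Def. 7.2, §7.5.3.
-/

namespace Summit.QuantumAdvantage.QuantumAdvantage.Theorems

open Literature.Computability.Complexity Literature.Computability.Complexity.Classes
  Literature.Computability.Cryptography Literature.Computability.QuantumComplexity

/-! ### The two sandwich identities -/

/-- **Below `BPP`.** For any class `C ⊆ BPP`: `BQP ⊄ C` iff the summit holds or `BPP ⊄ C`
(uses the tree's proved `BPP ⊆ BQP`). -/
theorem soloBlind_below_iff {C : Set (Language Bool)} (hC : C ⊆ BPP) :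
    ¬ (BQP ⊆ C) ↔ _root_.QuantumAdvantage ∨ ¬ (BPP ⊆ C) := by
  rw [soloBlind_quantumAdvantage_iff_not_subset]
  constructor
  · intro h
    by_contra h'
    obtain ⟨h₁, h₂⟩ := not_or.1 h'
    exact h ((not_not.1 h₁).trans (not_not.1 h₂))
  · rintro (h | h) hQC
    · exact h (hQC.trans hC)
    · exact h (BPP_subset_BQP_holds.trans hQC)

/-- **Above `BQP`.** For any class `D ⊇ BQP`: `D ⊄ BPP` iff the summit holds or `D ⊄ BQP`
(uses the tree's proved `BPP ⊆ BQP`). -/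
theorem soloBlind_above_iff {D : Set (Language Bool)} (hD : BQP ⊆ D) :
    ¬ (D ⊆ BPP) ↔ _root_.QuantumAdvantage ∨ ¬ (D ⊆ BQP) := by
  rw [soloBlind_quantumAdvantage_iff_not_subset]
  constructor
  · intro h
    by_contra h'
    obtain ⟨h₁, h₂⟩ := not_or.1 h'
    exact h ((not_not.1 h₂).trans (not_not.1 h₁))
  · rintro (h | h) hDB
    · exact h (hD.trans hDB)
    · exact h (hDB.trans BPP_subset_BQP_holds)

/-- Summit ⇒ every rung below: `BQP ⊄ C` for each `C ⊆ BPP`. -/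
theorem soloBlind_below_of_summit {C : Set (Language Bool)} (hC : C ⊆ BPP)
    (h : _root_.QuantumAdvantage) : ¬ (BQP ⊆ C) :=
  (soloBlind_below_iff hC).2 (Or.inl h)

/-! ### Rungs below `BPP` -/

/-- `C = P`: "`BQP ≠ P`" (as `BQP ⊄ P`) is `Summit ∨ BPP ⊄ P`; both disjuncts are open. -/
theorem soloBlind_not_BQP_subset_P_iff :
    ¬ (BQP ⊆ P) ↔ _root_.QuantumAdvantage ∨ ¬ (BPP ⊆ P) :=
  soloBlind_below_iff P_subset_BPP_holds

/-- … and this lowest rung already carries the curse of the ceiling: `BQP ⊄ P ⇒ P ≠ PSPACE`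
(tree: `BQP ⊆ PSPACE`). -/
theorem soloBlind_P_ne_PSPACE_of_not_BQP_subset_P (h : ¬ (BQP ⊆ P)) : P ≠ PSPACE :=
  fun he => h (BQP_subset_PSPACE_holds.trans he.ge)

/-- `C = RP`: `BQP ⊄ RP ↔ Summit ∨ BPP ⊄ RP` (tree: `RP ⊆ BPP`). -/
theorem soloBlind_not_BQP_subset_RP_iff :
    ¬ (BQP ⊆ RP) ↔ _root_.QuantumAdvantage ∨ ¬ (BPP ⊆ RP) :=
  soloBlind_below_iff RP_subset_BPP_holds

/-- `C = ZPP = RP ∩ coRP`: `BQP ⊄ ZPP ↔ Summit ∨ BPP ≠ ZPP` (as `BPP ⊄ ZPP`). -/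
theorem soloBlind_not_BQP_subset_ZPP_iff :
    ¬ (BQP ⊆ ZPP) ↔ _root_.QuantumAdvantage ∨ ¬ (BPP ⊆ ZPP) :=
  soloBlind_below_iff (Set.inter_subset_left.trans RP_subset_BPP_holds)

/-- **The fixed-polynomial rungs** `R_k : BQP ⊄ BPTIME(n^k)`:
`R_k ↔ Summit ∨ BPP ⊄ BPTIME(n^k)` (tree: `BPTime (· ^ k) ⊆ BPP`). The right disjunct is the
advice-free fixed-polynomial BPTIME hierarchy, open for every `k ≥ 1` (known with one bit of advice:
Barak 2002, Fortnow–Santhanam 2004; Fortnow–Santhanam–Trevisan 2004, Thm. 1). -/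
theorem soloBlind_fixedPoly_rung_iff (k : ℕ) :
    ¬ (BQP ⊆ BPTime fun n => n ^ k) ↔ _root_.QuantumAdvantage ∨ ¬ (BPP ⊆ BPTime fun n => n ^ k) :=
  soloBlind_below_iff (BPTime_pow_subset_BPP k)

/-- `k = 1`: "polynomial-time quantum computation is not contained in bounded-error probabilistic
LINEAR time" is `Summit ∨ BPTIME(n) ≠ BPP` — the Fortnow–Sipser (1989, retracted 1997) /
Rettinger–Verbeek (2001) hierarchy question as the classical disjunct. -/
theorem soloBlind_linear_rung_iff :
    ¬ (BQP ⊆ BPTime fun n => n) ↔ _root_.QuantumAdvantage ∨ ¬ (BPP ⊆ BPTime fun n => n) := by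
  simpa using soloBlind_fixedPoly_rung_iff 1

/-- Summit ⇒ `R_k` for every `k`. -/
theorem soloBlind_fixedPoly_rung_of_summit (h : _root_.QuantumAdvantage) (k : ℕ) :
    ¬ (BQP ⊆ BPTime fun n => n ^ k) :=
  soloBlind_below_of_summit (BPTime_pow_subset_BPP k) h

/-- The family form: `(∀ k, R_k) ↔ Summit ∨ (∀ k, BPP ⊄ BPTIME(n^k))`. (For the semantic class `BPP`,
lacking complete problems, `∀ k, BPP ⊄ BPTIME(n^k)` is a priori weaker than a single language of `BPP`
outside every `BPTIME(n^k)`; likewise `∀ k, R_k` is a priori weaker than the summit.) -/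
theorem soloBlind_fixedPoly_family_iff :
    (∀ k : ℕ, ¬ (BQP ⊆ BPTime fun n => n ^ k)) ↔
      _root_.QuantumAdvantage ∨ ∀ k : ℕ, ¬ (BPP ⊆ BPTime fun n => n ^ k) := by
  simp only [soloBlind_fixedPoly_rung_iff]
  exact forall_or_left

/-- Unlike "`BQP ≠ P`" (which forces `P ≠ PSPACE`), the fixed-polynomial rungs HOLD in the world
`P = PSPACE`: there `BPP = PSPACE`, and `PSPACE ⊄ BPTIME(n^k)` (standard: `BPTIME(n^k) ⊆ DSPACE(n^k)`
and the space hierarchy; taken here as the hypothesis `hsp`, the tree has no space-bounded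
simulation of `BPTime`). So no proof of `R_k` is forced to separate `P` from `PSPACE`. -/
theorem soloBlind_fixedPoly_rung_of_P_eq_PSPACE (k : ℕ)
    (hsp : ¬ (PSPACE ⊆ BPTime fun n => n ^ k)) (he : P = PSPACE) :
    ¬ (BQP ⊆ BPTime fun n => n ^ k) :=
  (soloBlind_fixedPoly_rung_iff k).2
    (Or.inr fun hB => hsp (he.ge.trans (P_subset_BPP_holds.trans hB)))

/-! ### Rungs above `BQP` -/

/-- `BQQP = BQTIME(quasipoly)` (local notation, as in `SoloBlindRung.lean`). -/
local notation "BQQP" => (⋃ k : ℕ, BQTime (fun n : ℕ => 2 ^ Nat.log 2 n ^ k))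

/-- **The v3 rung, padding-free.** `S' = BQTIME(quasipoly) ⊄ BPP` is exactly
"summit ∨ the QUANTUM quasi-polynomial time hierarchy `BQTIME(quasipoly) ⊄ BQP`" — sorry-free and
hypothesis-free (contrast `soloBlind_rung_iff`, whose classical reading `Summit ∨ BPTIME(quasipoly) ⊄ BPP`
needs three padding facts). The quantum hierarchy disjunct is open (semantic class; known with one bit of
advice, Fortnow–Santhanam–Trevisan 2004, Thm. 2 with `CTIME = BQTIME`). -/
theorem soloBlind_rung_iff_quantumHierarchy :
    ¬ (BQQP ⊆ BPP) ↔ _root_.QuantumAdvantage ∨ ¬ (BQQP ⊆ BQP) :=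
  soloBlind_above_iff soloBlind_BQP_subset_BQQP

/-- Its negation: the one uncovered world of the rung, read on the quantum side —
`BQP ⊆ BPP` together with the collapse `BQTIME(quasipoly) ⊆ BQP`. -/
theorem soloBlind_not_rung_iff_quantum :
    ¬ ¬ (BQQP ⊆ BPP) ↔ BQP ⊆ BPP ∧ BQQP ⊆ BQP := by
  rw [soloBlind_rung_iff_quantumHierarchy, not_or, soloBlind_quantumAdvantage_iff_not_subset, not_not,
    not_not]

/-- `D = PP`: the ceiling separation `PP ⊄ BPP` is `Summit ∨ PP ⊄ BQP` (tree: `BQP ⊆ PP`). -/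
theorem soloBlind_not_PP_subset_BPP_iff :
    ¬ (PP ⊆ BPP) ↔ _root_.QuantumAdvantage ∨ ¬ (PP ⊆ BQP) :=
  soloBlind_above_iff BQP_subset_PP_holds

/-- `D = PSPACE`: `PSPACE ⊄ BPP ↔ Summit ∨ PSPACE ⊄ BQP` (tree: `BQP ⊆ PSPACE`). -/
theorem soloBlind_not_PSPACE_subset_BPP_iff :
    ¬ (PSPACE ⊆ BPP) ↔ _root_.QuantumAdvantage ∨ ¬ (PSPACE ⊆ BQP) :=
  soloBlind_above_iff BQP_subset_PSPACE_holds



end Summit.QuantumAdvantage.QuantumAdvantage.Theorems
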